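import Literature.NumberTheory.EllipticCurves.IsogenyRamification
import Literature.NumberTheory.EllipticCurves.IsogenyQuotientPlacesProofs
import Literature.NumberTheory.EllipticCurves.IsogenyDualFiniteFieldProofs
import Mathlib.FieldTheory.Galois.Infinite
import HarnessLib

/-!
# Isogenies of degree one are admissible changes of variables (towards CSIDH Prop. 8)

Sibling *proofs* file (theorems only, D-0014/D-0026) of
`Literature.Computability.Cryptography.CsidhAction`, working towards the named fact
`csidh_classGroupAction` (Castryck–Lange–Martindale–Panny–Renes, *CSIDH*, ASIACRYPT 2018): the
bridge between the tree's isogenies of degree one (maps on `K̄`-points) and Weierstrass changes of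
variables, i.e. Silverman, *AEC*, Prop. III.3.1(b) ("any two Weierstrass equations for `E` … are
related by a linear change of variables of the form `X = u²X' + r`, `Y = u³Y' + su²X' + t`"),
read for an isogeny `μ : E → E'` of degree `deg μ = [K̄(E) : μ^* K̄(E')] = 1`.

Main result: `exists_variableChange_of_deg_eq_one` — for elliptic curves `W, W'` over a
**perfect** field `K` and an isogeny `μ : W → W'` over `K` (the tree's `WeierstrassCurve.Isogeny`)
with `μ.deg = 1`, there is `C : VariableChange K` with `C • W' = W`.

## Stage 1: the pull-backs `μ^* x'`, `μ^* y'` are linear in `x, y`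

* `ord_zero_Y`, `ord_zero_yF`: `ord_O y = -3` (the tree's `infValuationF_y`);
* `exists_eq_lin_of_ordAt`: a function `u ∈ K̄(E)` regular at every affine point with
  `ord_O u ≥ -3` is `a + b x + c y` (`u ∈ K̄[E]` by the tree's
  `exists_algebraMap_eq_of_forall_placeValuation_le_one`, then `u = p(x) + q(x) y` with
  `max (2 deg p, 2 deg q + 3) = -ord_O u ≤ 3`, Mathlib's `CoordinateRing.exists_smul_basis_eq` and
  the tree's `normDeg_smul_basis`) — the spaces `L(2(O)) = ⟨1, x⟩`, `L(3(O)) = ⟨1, x, y⟩` of the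
  proof of Prop. III.3.1;
* `Isogeny.ramIdx_eq_one_of_deg_eq_one`, `Isogeny.eq_zero_of_deg_eq_one`: a degree-one isogeny
  is unramified with trivial kernel (`e · #ker = deg`, the tree's `ramIdx_mul_card_ker`);
* `Isogeny.exists_pullback_eq_lin_of_deg_eq_one`: for `deg μ = 1`,
  `μ^* x' = a + c x` and `μ^* y' = e + f x + d y` with `c d ≠ 0` (`ord_P(μ^* z) = ord_{μP}(z)`,
  the tree's `ordAt_pullbackHom_eq`, so `μ^* x'`, `μ^* y'` are regular off `O` with
  `ord_O = -2, -3`).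

## Stage 2: the six coefficient identities and the change of variables they define

* `coeff_relations_of_pullback_eq_lin`: substituting the linear pull-backs into the equation of
  `E'` (the tree's `Isogeny.equation_pullback`) and reducing `y²` by the equation of `E` gives
  `p(x) + q(x) y = 0` in `K̄(E)`, hence six scalar identities (`1, y` is a `K̄[x]`-basis of
  `K̄[E]`, Mathlib's `CoordinateRing.smul_basis_eq_zero`);
* `variableChange_smul_eq_of_relations`: over any field these identities say exactly that
  `(u, r, s, t) = (d/c, a, f/c, e)` carries `W'` to `W` (Silverman, *AEC*, Table 3.1).

## Stage 3: Galois descent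

* `xy_apply_eq_of_pullback_eq_lin`: off a finite set, `μ(x, y) = (a + cx, e + fx + dy)` on
  `K̄`-points (values of pull-backs, the tree's `hasValueAt_pullbackHom`);
* `smul_eq_of_pullback_eq_lin`: as `μ` commutes with `Γ_K`, the five coefficients are
  `Γ_K`-fixed (compare at a generic point, its opposite, and a second generic point);
* `exists_variableChange_of_deg_eq_one`: for `K` perfect, `K̄^{Γ_K} = K` (Mathlib's
  `InfiniteGalois.mem_range_algebraMap_iff_fixed`), the identities descend to `K` and define
  `C : VariableChange K` with `C • W' = W`.

## References

* [SilvermanAEC2009] J. H. Silverman, *The Arithmetic of Elliptic Curves*, 2nd ed., GTM 106: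
  Prop. III.3.1(b) and its proof (Riemann–Roch spaces `L(2(O))`, `L(3(O))`), II.§2
  (`ord_P(φ^* f) = e_φ(P) ord_{φP}(f)`), III.§1 (`ord_O x = -2`, `ord_O y = -3`).
* [CastryckEtAl2018] W. Castryck, T. Lange, C. Martindale, L. Panny, J. Renes, *CSIDH*,
  ASIACRYPT 2018, §5 Prop. 8 (uniqueness of the Montgomery coefficient: "by
  [59, Proposition III.3.1(b)] there exist `u ∈ 𝔽_p^*` and `r, s, t ∈ 𝔽_p` such that …").

## Design

`noncomputable section`, `open scoped Classical`; theorems only, no definitions, no new named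
facts. General over a field `K : Type u` and elliptic `W W' : WeierstrassCurve K`; kept in the
CSIDH namespace (dot-notation extensions on `WeierstrassCurve.Isogeny` are avoided to keep the
elliptic-curve library's namespace untouched).
-/

noncomputable section

open scoped Classical
open scoped Polynomial.Bivariate
open Polynomial

universe u

namespace Literature.Computability.Cryptography.Csidh

open WeierstrassCurve WeierstrassCurve.geomPoints
open Literature.NumberTheory.EllipticCurves.WeierstrassFunctionField

section Linear

variable {K : Type u} [Field K] {W W' : WeierstrassCurve K} [W.IsElliptic] [W'.IsElliptic]

/-! ### `ord_O y = -3` and regularity of `y` -/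

omit [W.IsElliptic] in
/-- `ord_O y = -3` on a Weierstrass curve over any field (the tree's `infValuationF_y`).
[cite: SilvermanAEC2009, III.§1 (`ord_O y = -3`)] -/
theorem ord_zero_Y {k : Type u} [Field k] (V : WeierstrassCurve.Affine k) [V.IsElliptic] :
    ord V 0 (yF V) = -3 := by
  rw [ord, placeValuation_zero, yF,
    Literature.NumberTheory.DiophantineGeometry.WeierstrassPlaceAtInfinity.infValuationF_y,
    WithZero.log_exp]

/-- `ord_O y = -3` in `K̄(E)`. [cite: SilvermanAEC2009, III.§1 (`ord_O y = -3`)] -/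
theorem ord_zero_yF : W.ordAt 0 W.genY = -3 :=
  ord_zero_Y _

/-- `y ≠ 0` in `K̄(E)`. [folklore] -/
theorem genY_ne_zero : W.genY ≠ 0 := by
  intro h0
  have h1 := ord_zero_yF (W := W)
  rw [h0] at h1
  simp [WeierstrassCurve.ordAt, ord] at h1

/-- `y` is regular at affine points: `ord_R y ≥ 0` for `R ≠ O`. [folklore] -/
theorem ordAt_genY_nonneg {R : W.geomPoints} (hR : R ≠ 0) : 0 ≤ W.ordAt R W.genY := by
  obtain ⟨a, b, h, rfl⟩ := geomPoints.exists_eq_some hR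
  have hv : placeValuation (W.baseChange (AlgebraicClosure K)).toAffine (.some a b h) W.genY ≤ 1 :=
    placeValuation_some_algebraMap_le_one h _
  exact (placeValuation_le_one_iff_ord_nonneg _ genY_ne_zero).mp hv

/-! ### `L(3(O)) = ⟨1, x, y⟩` -/

omit [W.IsElliptic] in
/-- Degree bookkeeping for `deg N(p + q y) = max (2 deg p, 2 deg q + 3)` (cast to `ℕ`).
[folklore] -/
theorem natDegree_data_of_eq_max {k : Type u} [Field k] {p q : k[X]} {n : ℕ}
    (h : (n : WithBot ℕ) = max (2 • p.degree) (2 • q.degree + 3)) :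
    (q = 0 → p ≠ 0 ∧ n = 2 * p.natDegree) ∧
    (q ≠ 0 → p = 0 → n = 2 * q.natDegree + 3) ∧
    (q ≠ 0 → p ≠ 0 → n = max (2 * p.natDegree) (2 * q.natDegree + 3)) := by
  have cast2 : ∀ d : ℕ, 2 • (d : WithBot ℕ) = ((2 * d : ℕ) : WithBot ℕ) := fun d ↦ by
    rw [two_nsmul, two_mul, Nat.cast_add]
  have cast3 : ∀ d : ℕ, 2 • (d : WithBot ℕ) + 3 = ((2 * d + 3 : ℕ) : WithBot ℕ) := fun d ↦ by
    rw [two_nsmul, two_mul, Nat.cast_add, Nat.cast_add, Nat.cast_ofNat]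
  have bot2 : 2 • (⊥ : WithBot ℕ) = ⊥ := by rw [two_nsmul, WithBot.bot_add]
  have bot3 : 2 • (⊥ : WithBot ℕ) + 3 = ⊥ := by rw [two_nsmul, WithBot.bot_add, WithBot.bot_add]
  have inj : ∀ a b : ℕ, (a : WithBot ℕ) = b → a = b := fun a b hab ↦ by
    rwa [Nat.cast_withBot, Nat.cast_withBot, WithBot.coe_eq_coe] at hab
  refine ⟨fun hq ↦ ?_, fun hq hp ↦ ?_, fun hq hp ↦ ?_⟩
  · rw [hq, degree_zero, bot3, max_bot_right] at h
    by_cases hp : p = 0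
    · rw [hp, degree_zero, bot2, Nat.cast_withBot] at h
      exact absurd h WithBot.coe_ne_bot
    · rw [degree_eq_natDegree hp, cast2] at h
      exact ⟨hp, inj _ _ h⟩
  · rw [hp, degree_zero, bot2, max_bot_left, degree_eq_natDegree hq, cast3] at h
    exact inj _ _ h
  · rw [degree_eq_natDegree hp, degree_eq_natDegree hq, cast2, cast3] at h
    apply inj
    rw [h, Nat.cast_withBot, Nat.cast_withBot, Nat.cast_withBot, WithBot.coe_max]

/-- **`L(3(O)) = ⟨1, x, y⟩`, `L(2(O)) = ⟨1, x⟩`** (Silverman, *AEC*, proof of Prop. III.3.1):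
a function `u ≠ 0` on `E / K̄` with `ord_R u ≥ 0` at every affine `R` and `ord_O u ≥ -3` is
`u = a + b x + c y`; if `ord_O u = -2` then `c = 0 ≠ b`, and if `ord_O u = -3` then `c ≠ 0`.
Proof: `u ∈ K̄[E]` (a function regular on the affine part is a regular function), `u = p(x) + q(x)y`
with `-ord_O u = max (2 deg p, 2 deg q + 3)`. [cite: SilvermanAEC2009, Prop. III.3.1 (proof)] -/
theorem exists_eq_lin_of_ordAt {u : W.geomFunctionField} (hu : u ≠ 0)
    (hreg : ∀ R : W.geomPoints, R ≠ 0 → 0 ≤ W.ordAt R u) (h3 : -3 ≤ W.ordAt 0 u) :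
    ∃ a b c : AlgebraicClosure K,
      u = algebraMap _ W.geomFunctionField a + algebraMap _ W.geomFunctionField b * W.genX +
          algebraMap _ W.geomFunctionField c * W.genY ∧
      (W.ordAt 0 u = -2 → c = 0 ∧ b ≠ 0) ∧ (W.ordAt 0 u = -3 → c ≠ 0) := by
  -- `u` is a regular function
  obtain ⟨w, hw⟩ := exists_algebraMap_eq_of_forall_placeValuation_le_one
    (V := (W.baseChange (AlgebraicClosure K)).toAffine) (u := u)
    (fun a b hab ↦ (placeValuation_le_one_iff_ord_nonneg _ hu).mpr
      (hreg (.some a b hab) (Affine.Point.some_ne_zero hab)))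
  have hw0 : w ≠ 0 := by
    rintro rfl
    exact hu (by rw [← hw, map_zero])
  obtain ⟨p, q, hpq⟩ := Affine.CoordinateRing.exists_smul_basis_eq w
  have hpq0 : p • (1 : (W.baseChange (AlgebraicClosure K)).toAffine.CoordinateRing) +
      q • Affine.CoordinateRing.mk (W.baseChange (AlgebraicClosure K)).toAffine Y ≠ 0 := by
    rw [hpq]; exact hw0
  -- `-ord_O u = deg N(w) = max (2 deg p, 2 deg q + 3) ≤ 3`
  have hordw : W.ordAt 0 u = -(normDeg (W.baseChange (AlgebraicClosure K)).toAffine w : ℤ) := by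
    rw [← hw]
    exact ord_zero_algebraMap hw0
  have hnd : (normDeg (W.baseChange (AlgebraicClosure K)).toAffine w : WithBot ℕ) =
      max (2 • p.degree) (2 • q.degree + 3) := by
    rw [← hpq]
    exact normDeg_smul_basis hpq0
  obtain ⟨dq0, dp0, dpq⟩ := natDegree_data_of_eq_max hnd
  have hn3 : normDeg (W.baseChange (AlgebraicClosure K)).toAffine w ≤ 3 := by
    rw [hordw] at h3
    omega
  have hdeg : q.natDegree = 0 ∧ p.natDegree ≤ 1 := by
    by_cases hq : q = 0
    · obtain ⟨-, hn⟩ := dq0 hq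
      rw [hq, natDegree_zero]
      exact ⟨rfl, by omega⟩
    · by_cases hp : p = 0
      · have hn := dp0 hq hp
        rw [hp, natDegree_zero]
        exact ⟨by omega, zero_le_one⟩
      · have hn := dpq hq hp
        constructor <;> omega
  obtain ⟨hqdeg, hpdeg⟩ := hdeg
  -- `p = b X + a`, `q = c`
  have hp : p = C (p.coeff 1) * X + C (p.coeff 0) := eq_X_add_C_of_natDegree_le_one hpdeg
  have hq : q = C (q.coeff 0) := eq_C_of_natDegree_eq_zero hqdeg
  refine ⟨p.coeff 0, p.coeff 1, q.coeff 0, ?_, ?_, ?_⟩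
  · -- the expansion of `algebraMap w`
    have hu' : u = aeval (xF (W.baseChange (AlgebraicClosure K)).toAffine) p +
        aeval (xF (W.baseChange (AlgebraicClosure K)).toAffine) q *
          yF (W.baseChange (AlgebraicClosure K)).toAffine := by
      rw [← hw, ← hpq, Affine.CoordinateRing.smul, Affine.CoordinateRing.smul, mul_one, ← map_mul,
        ← map_add, Literature.NumberTheory.EllipticCurves.WeierstrassFunctionField.algebraMap_mk,
        map_add, map_mul, aevalAeval_C, aevalAeval_C, aevalAeval_Y]
    rw [hu']
    conv_lhs => rw [hp, hq]
    simp only [map_add, map_mul, aeval_C, aeval_X]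
    change _ = _ + _ * xF _ + _ * yF _
    ring
  · -- `ord_O u = -2`: `normDeg = 2`, so `q = 0` and `deg p = 1`
    intro h2
    have hn2 : normDeg (W.baseChange (AlgebraicClosure K)).toAffine w = 2 := by
      rw [hordw] at h2; omega
    have hq0 : q = 0 := by
      by_contra hq0
      by_cases hp0 : p = 0
      · have := dp0 hq0 hp0; omega
      · have := dpq hq0 hp0; omega
    obtain ⟨hp0, hn⟩ := dq0 hq0
    refine ⟨by rw [hq0, coeff_zero], ?_⟩
    have hdp : p.natDegree = 1 := by omega
    have hlc : p.leadingCoeff ≠ 0 := leadingCoeff_ne_zero.mpr hp0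
    rwa [leadingCoeff, hdp] at hlc
  · -- `ord_O u = -3`: `normDeg = 3`, so `q ≠ 0` (and `deg q = 0`)
    intro h3' hc
    have hn3' : normDeg (W.baseChange (AlgebraicClosure K)).toAffine w = 3 := by
      rw [hordw] at h3'; omega
    have hq0 : q ≠ 0 := by
      intro hq0
      obtain ⟨-, hn⟩ := dq0 hq0
      omega
    exact hq0 (by rw [hq, hc, map_zero])

/-! ### Degree-one isogenies: unramified, trivial kernel, linear pull-backs -/

/-- **A degree-one isogeny is unramified with trivial kernel**: `e_μ = 1` and `#ker μ = 1`
(`e_μ · #ker μ = deg μ`, the tree's `ramIdx_mul_card_ker`). [cite: SilvermanAEC2009, Thm. III.4.10(a)] -/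
theorem ramIdx_eq_one_of_deg_eq_one (μ : Isogeny W W') (hdeg : μ.deg = 1) :
    μ.ramIdx = 1 ∧ Nat.card μ.toAddMonoidHom.ker = 1 := by
  have h := μ.ramIdx_mul_card_ker
  rw [hdeg] at h
  exact ⟨Nat.eq_one_of_mul_eq_one_right h, Nat.eq_one_of_mul_eq_one_left h⟩

/-- A degree-one isogeny is injective on `K̄`-points. [folklore] -/
theorem eq_zero_of_deg_eq_one (μ : Isogeny W W') (hdeg : μ.deg = 1) {P : W.geomPoints}
    (hP : μ P = 0) : P = 0 := by
  have hbot : μ.toAddMonoidHom.ker = ⊥ :=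
    (AddSubgroup.card_eq_one).mp (ramIdx_eq_one_of_deg_eq_one μ hdeg).2
  have : P ∈ μ.toAddMonoidHom.ker := by
    rw [AddMonoidHom.mem_ker]
    exact hP
  rwa [hbot, AddSubgroup.mem_bot] at this

/-- For a degree-one isogeny, `ord_P(μ^* z) = ord_{μP}(z)`. [cite: SilvermanAEC2009, II.§2] -/
theorem ordAt_pullbackHom_of_deg_eq_one (μ : Isogeny W W') (hdeg : μ.deg = 1)
    (P : W.geomPoints) (z : W'.geomFunctionField) :
    W.ordAt P (μ.pullbackHom z) = W'.ordAt (μ P) z := by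
  rw [μ.ordAt_pullbackHom_eq, (ramIdx_eq_one_of_deg_eq_one μ hdeg).1, Nat.cast_one, one_mul]

/-- **The pull-backs of the coordinates along a degree-one isogeny are linear**: for an isogeny
`μ : E → E'` of elliptic curves over `K` with `deg μ = 1` there are `a, c, e, f, d ∈ K̄` with
`c ≠ 0`, `d ≠ 0` and `μ^* x' = a + c x`, `μ^* y' = e + f x + d y` in `K̄(E)` — `μ^* x'` and
`μ^* y'` are regular off `O` (`μ` is injective, `x'`, `y'` are regular on the affine part) with
`ord_O = -2, -3` (`μ` is unramified), so they lie in `L(2(O)) = ⟨1, x⟩`, `L(3(O)) = ⟨1, x, y⟩`.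
Silverman, *AEC*, proof of Prop. III.3.1(b). [cite: SilvermanAEC2009, Prop. III.3.1(b) (proof)] -/
theorem exists_pullback_eq_lin_of_deg_eq_one (μ : Isogeny W W') (hdeg : μ.deg = 1) :
    ∃ a c e f d : AlgebraicClosure K, c ≠ 0 ∧ d ≠ 0 ∧
      μ.pullbackX = algebraMap _ W.geomFunctionField a + algebraMap _ W.geomFunctionField c * W.genX ∧
      μ.pullbackY = algebraMap _ W.geomFunctionField e + algebraMap _ W.geomFunctionField f * W.genX +
        algebraMap _ W.geomFunctionField d * W.genY := by
  -- `μ^* x'`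
  have hx0 : μ.pullbackX ≠ 0 := fun h0 ↦ μ.transcendental_pullbackX (h0 ▸ isAlgebraic_zero)
  have hxreg : ∀ R : W.geomPoints, R ≠ 0 → 0 ≤ W.ordAt R μ.pullbackX := fun R hR ↦ by
    rw [← μ.pullbackHom_genX, ordAt_pullbackHom_of_deg_eq_one μ hdeg]
    exact ordAt_genX_nonneg fun h ↦ hR (eq_zero_of_deg_eq_one μ hdeg h)
  have hx2 : W.ordAt 0 μ.pullbackX = -2 := by
    rw [← μ.pullbackHom_genX, ordAt_pullbackHom_of_deg_eq_one μ hdeg, map_zero, ordAt_zero_genX]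
  obtain ⟨a, c, c', hxe, hx2', -⟩ := exists_eq_lin_of_ordAt hx0 hxreg (by rw [hx2]; norm_num)
  obtain ⟨hc', hc⟩ := hx2' hx2
  -- `μ^* y'`
  have hy0 : μ.pullbackY ≠ 0 := by
    intro h0
    have h1 : μ.pullbackHom W'.genY = μ.pullbackHom 0 := by rw [μ.pullbackHom_genY, h0, map_zero]
    exact genY_ne_zero (μ.pullbackHom.toRingHom.injective h1)
  have hyreg : ∀ R : W.geomPoints, R ≠ 0 → 0 ≤ W.ordAt R μ.pullbackY := fun R hR ↦ by
    rw [← μ.pullbackHom_genY, ordAt_pullbackHom_of_deg_eq_one μ hdeg]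
    exact ordAt_genY_nonneg fun h ↦ hR (eq_zero_of_deg_eq_one μ hdeg h)
  have hy3 : W.ordAt 0 μ.pullbackY = -3 := by
    rw [← μ.pullbackHom_genY, ordAt_pullbackHom_of_deg_eq_one μ hdeg, map_zero, ord_zero_yF]
  obtain ⟨e, f, d, hye, -, hy3'⟩ := exists_eq_lin_of_ordAt hy0 hyreg (by rw [hy3])
  have hd := hy3' hy3
  refine ⟨a, c, e, f, d, hc, hd, ?_, hye⟩
  rw [hxe, hc', map_zero, zero_mul, add_zero]

end Linear

/-! ## Stage 2: the six coefficient identities, and the change of variables they define -/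

section Coefficients

variable {K : Type u} [Field K] {W W' : WeierstrassCurve K} [W.IsElliptic] [W'.IsElliptic]

omit [W.IsElliptic] [W'.IsElliptic] in
/-- `p • 1 + q • y ↦ p(x) + q(x) y` under `K̄[E] → K̄(E)`, for the cubic-and-linear shape used
below. [folklore] -/
theorem algebraMap_smul_basis_cubic (P₀ P₁ P₂ P₃ Q₀ Q₁ : AlgebraicClosure K) :
    algebraMap (W.baseChange (AlgebraicClosure K)).toAffine.CoordinateRing W.geomFunctionField
      ((C P₀ + C P₁ * X + C P₂ * X ^ 2 + C P₃ * X ^ 3) •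
          (1 : (W.baseChange (AlgebraicClosure K)).toAffine.CoordinateRing) +
        (C Q₀ + C Q₁ * X) • Affine.CoordinateRing.mk (W.baseChange (AlgebraicClosure K)).toAffine Y) =
      algebraMap _ W.geomFunctionField P₀ + algebraMap _ W.geomFunctionField P₁ * W.genX +
        algebraMap _ W.geomFunctionField P₂ * W.genX ^ 2 +
        algebraMap _ W.geomFunctionField P₃ * W.genX ^ 3 +
        (algebraMap _ W.geomFunctionField Q₀ + algebraMap _ W.geomFunctionField Q₁ * W.genX) *
          W.genY := by
  rw [Affine.CoordinateRing.smul, Affine.CoordinateRing.smul, mul_one, ← map_mul, ← map_add,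
    Literature.NumberTheory.EllipticCurves.WeierstrassFunctionField.algebraMap_mk, map_add,
    map_mul, aevalAeval_C, aevalAeval_C, aevalAeval_Y]
  simp only [map_add, map_mul, map_pow, aeval_C, aeval_X]

omit [W.IsElliptic] [W'.IsElliptic] in
/-- `p(x) + q(x) y = 0` in `K̄(E)` with `deg p ≤ 3`, `deg q ≤ 1` forces all coefficients to
vanish (`1, y` is a `K̄[x]`-basis of `K̄[E] ⊆ K̄(E)`, Mathlib's `CoordinateRing.smul_basis_eq_zero`).
[folklore] -/
theorem coeffs_eq_zero_of_lin_eq_zero {P₀ P₁ P₂ P₃ Q₀ Q₁ : AlgebraicClosure K}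
    (h : algebraMap _ W.geomFunctionField P₀ + algebraMap _ W.geomFunctionField P₁ * W.genX +
        algebraMap _ W.geomFunctionField P₂ * W.genX ^ 2 +
        algebraMap _ W.geomFunctionField P₃ * W.genX ^ 3 +
        (algebraMap _ W.geomFunctionField Q₀ + algebraMap _ W.geomFunctionField Q₁ * W.genX) *
          W.genY = 0) :
    P₀ = 0 ∧ P₁ = 0 ∧ P₂ = 0 ∧ P₃ = 0 ∧ Q₀ = 0 ∧ Q₁ = 0 := by
  rw [← algebraMap_smul_basis_cubic] at h
  have h0 := (IsFractionRing.injective (W.baseChange (AlgebraicClosure K)).toAffine.CoordinateRing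
    W.geomFunctionField) (h.trans (map_zero _).symm)
  obtain ⟨hp, hq⟩ := Affine.CoordinateRing.smul_basis_eq_zero h0
  refine ⟨?_, ?_, ?_, ?_, ?_, ?_⟩
  · simpa using congrArg (Polynomial.coeff · 0) hp
  · simpa using congrArg (Polynomial.coeff · 1) hp
  · simpa using congrArg (Polynomial.coeff · 2) hp
  · simpa using congrArg (Polynomial.coeff · 3) hp
  · simpa using congrArg (Polynomial.coeff · 0) hq
  · simpa using congrArg (Polynomial.coeff · 1) hq

omit [W'.IsElliptic] in
/-- **The six coefficient identities of a linear pull-back.** If an isogeny `μ : E → E'` over `K`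
pulls back the coordinates linearly, `μ^* x' = a + c x`, `μ^* y' = e + f x + d y`, then
substituting into the equation of `E'` (satisfied by `(μ^* x', μ^* y')`, the tree's
`Isogeny.equation_pullback`) and reducing `y²` with the equation of `E` gives `p(x) + q(x) y = 0`
with `deg p ≤ 3`, `deg q ≤ 1`; the coefficients (written with `αᵢ = a'ᵢ`, `βᵢ = aᵢ` in `K̄`) are
`d² - c³`, `f² + α₁cf - 3ac² - α₂c² + d²β₂`, `2ef + α₁(ce + af) + α₃f - 3a²c - 2α₂ac - α₄c + d²β₄`,
`e² + α₁ae + α₃e - a³ - α₂a² - α₄a - α₆ + d²β₆`, and `2df + dα₁c - d²β₁`, `2de + d(α₁a + α₃) - d²β₃`,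
all zero. This is the computation behind Silverman, *AEC*, Table 3.1 / Prop. III.3.1(b).
[cite: SilvermanAEC2009, Prop. III.3.1(b) and Table 3.1] -/
theorem coeff_relations_of_pullback_eq_lin (μ : Isogeny W W') {a c e f d : AlgebraicClosure K}
    (hx : μ.pullbackX = algebraMap _ W.geomFunctionField a + algebraMap _ W.geomFunctionField c * W.genX)
    (hy : μ.pullbackY = algebraMap _ W.geomFunctionField e + algebraMap _ W.geomFunctionField f * W.genX +
        algebraMap _ W.geomFunctionField d * W.genY) :
    d ^ 2 - c ^ 3 = 0 ∧
    f ^ 2 + algebraMap K _ W'.a₁ * c * f - 3 * a * c ^ 2 - algebraMap K _ W'.a₂ * c ^ 2 +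
      d ^ 2 * algebraMap K _ W.a₂ = 0 ∧
    2 * e * f + algebraMap K _ W'.a₁ * (c * e + a * f) + algebraMap K _ W'.a₃ * f - 3 * a ^ 2 * c -
      2 * algebraMap K _ W'.a₂ * a * c - algebraMap K _ W'.a₄ * c + d ^ 2 * algebraMap K _ W.a₄ = 0 ∧
    e ^ 2 + algebraMap K _ W'.a₁ * a * e + algebraMap K _ W'.a₃ * e - a ^ 3 -
      algebraMap K _ W'.a₂ * a ^ 2 - algebraMap K _ W'.a₄ * a - algebraMap K _ W'.a₆ +
      d ^ 2 * algebraMap K _ W.a₆ = 0 ∧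
    2 * d * f + d * algebraMap K _ W'.a₁ * c - d ^ 2 * algebraMap K _ W.a₁ = 0 ∧
    2 * d * e + d * (algebraMap K _ W'.a₁ * a + algebraMap K (AlgebraicClosure K) W'.a₃) -
      d ^ 2 * algebraMap K _ W.a₃ = 0 := by
  have hT : ∀ r : K, algebraMap K W.geomFunctionField r =
      algebraMap (AlgebraicClosure K) W.geomFunctionField (algebraMap K (AlgebraicClosure K) r) :=
    fun r ↦ IsScalarTower.algebraMap_apply K (AlgebraicClosure K) W.geomFunctionField r
  -- the two Weierstrass equations in `K̄(E)`
  have hE' := μ.equation_pullback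
  rw [Affine.equation_iff] at hE'
  simp only [WeierstrassCurve.baseChange, WeierstrassCurve.map_a₁, WeierstrassCurve.map_a₂,
    WeierstrassCurve.map_a₃, WeierstrassCurve.map_a₄, WeierstrassCurve.map_a₆, hT, hx, hy] at hE'
  have hE := equation_genX_genY W
  rw [Affine.equation_iff] at hE
  simp only [WeierstrassCurve.baseChange, WeierstrassCurve.map_a₁, WeierstrassCurve.map_a₂,
    WeierstrassCurve.map_a₃, WeierstrassCurve.map_a₄, WeierstrassCurve.map_a₆, hT] at hE
  -- `p(x) + q(x) y = 0`
  set φ := algebraMap (AlgebraicClosure K) W.geomFunctionField with hφ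
  set ι := algebraMap K (AlgebraicClosure K) with hι
  have key : φ (e ^ 2 + ι W'.a₁ * a * e + ι W'.a₃ * e - a ^ 3 - ι W'.a₂ * a ^ 2 - ι W'.a₄ * a -
        ι W'.a₆ + d ^ 2 * ι W.a₆) +
      φ (2 * e * f + ι W'.a₁ * (c * e + a * f) + ι W'.a₃ * f - 3 * a ^ 2 * c -
        2 * ι W'.a₂ * a * c - ι W'.a₄ * c + d ^ 2 * ι W.a₄) * W.genX +
      φ (f ^ 2 + ι W'.a₁ * c * f - 3 * a * c ^ 2 - ι W'.a₂ * c ^ 2 + d ^ 2 * ι W.a₂) * W.genX ^ 2 +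
      φ (d ^ 2 - c ^ 3) * W.genX ^ 3 +
      (φ (2 * d * e + d * (ι W'.a₁ * a + ι W'.a₃) - d ^ 2 * ι W.a₃) +
        φ (2 * d * f + d * ι W'.a₁ * c - d ^ 2 * ι W.a₁) * W.genX) * W.genY = 0 := by
    simp only [map_add, map_sub, map_mul, map_pow, map_ofNat]
    linear_combination hE' - (φ d) ^ 2 * hE
  obtain ⟨h0, h1, h2, h3, h4, h5⟩ := coeffs_eq_zero_of_lin_eq_zero key
  exact ⟨h3, h2, h1, h0, h5, h4⟩

/-- **Six identities define an admissible change of variables** (pure algebra, any field `k`):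
if `a, c, d, e, f ∈ k` with `c ≠ 0 ≠ d` satisfy the six identities of
`coeff_relations_of_pullback_eq_lin` for Weierstrass curves `V'` (coefficients `αᵢ`) and `V`
(coefficients `βᵢ`) over `k`, then `u = d/c` has `u² = c`, `u³ = d`, and the change of variables
`(u, r, s, t) = (d/c, a, f/c, e)` carries `V'` to `V` (Silverman, *AEC*, Table 3.1: `X = u²X' + r`,
`Y = u³Y' + su²X' + t`, as Mathlib's `VariableChange` action). [cite: SilvermanAEC2009, III.§1 Table 3.1] -/
theorem variableChange_smul_eq_of_relations {k : Type u} [Field k] (V V' : WeierstrassCurve k)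
    {a c e f d : k} (hc : c ≠ 0) (hd : d ≠ 0)
    (h3 : d ^ 2 - c ^ 3 = 0)
    (h2 : f ^ 2 + V'.a₁ * c * f - 3 * a * c ^ 2 - V'.a₂ * c ^ 2 + d ^ 2 * V.a₂ = 0)
    (h1 : 2 * e * f + V'.a₁ * (c * e + a * f) + V'.a₃ * f - 3 * a ^ 2 * c -
      2 * V'.a₂ * a * c - V'.a₄ * c + d ^ 2 * V.a₄ = 0)
    (h0 : e ^ 2 + V'.a₁ * a * e + V'.a₃ * e - a ^ 3 - V'.a₂ * a ^ 2 - V'.a₄ * a - V'.a₆ +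
      d ^ 2 * V.a₆ = 0)
    (h5 : 2 * d * f + d * V'.a₁ * c - d ^ 2 * V.a₁ = 0)
    (h4 : 2 * d * e + d * (V'.a₁ * a + V'.a₃) - d ^ 2 * V.a₃ = 0) :
    (⟨Units.mk0 (d / c) (div_ne_zero hd hc), a, f / c, e⟩ : VariableChange k) • V' = V := by
  -- `h5 = d · h5'`, `h4 = d · h4'`
  have h5' : 2 * f + V'.a₁ * c - d * V.a₁ = 0 := by
    have h : d * (2 * f + V'.a₁ * c - d * V.a₁) = 0 := by linear_combination h5
    exact (mul_eq_zero.mp h).resolve_left hd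
  have h4' : 2 * e + V'.a₁ * a + V'.a₃ - d * V.a₃ = 0 := by
    have h : d * (2 * e + V'.a₁ * a + V'.a₃ - d * V.a₃) = 0 := by linear_combination h4
    exact (mul_eq_zero.mp h).resolve_left hd
  ext
  · simp only [variableChange_a₁, Units.val_inv_eq_inv_val, Units.val_mk0]
    field_simp
    linear_combination h5'
  · simp only [variableChange_a₂, Units.val_inv_eq_inv_val, Units.val_mk0]
    field_simp
    linear_combination -h2
  · simp only [variableChange_a₃, Units.val_inv_eq_inv_val, Units.val_mk0]
    field_simp
    linear_combination c ^ 3 * h4' - V.a₃ * d * h3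
  · simp only [variableChange_a₄, Units.val_inv_eq_inv_val, Units.val_mk0]
    field_simp
    linear_combination
      (-(3 * a ^ 2 * c + 2 * V'.a₂ * a * c + V'.a₄ * c - 2 * e * f - V'.a₁ * (c * e + a * f) -
        V'.a₃ * f)) * h3 - d ^ 2 * h1
  · simp only [variableChange_a₆, Units.val_inv_eq_inv_val, Units.val_mk0]
    field_simp
    linear_combination
      (-(a ^ 3 + V'.a₂ * a ^ 2 + V'.a₄ * a + V'.a₆ - e ^ 2 - V'.a₁ * a * e - V'.a₃ * e) *
        (c ^ 3 + d ^ 2)) * h3 - d ^ 4 * h0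

end Coefficients

/-! ## Stage 3: values at points, Galois descent, and the change of variables over `K` -/

section Descent

variable {K : Type u} [Field K] {W W' : WeierstrassCurve K} [W.IsElliptic] [W'.IsElliptic]

omit [W.IsElliptic] in
/-- Two affine points with the same `x`-coordinate are equal or opposite (Mathlib's `X_eq_iff`).
[folklore] -/
theorem eq_or_eq_neg_of_xy_zero_eq {P Q : W.geomPoints} (hP : P ≠ 0) (hQ : Q ≠ 0)
    (h : xy P 0 = xy Q 0) : P = Q ∨ P = -Q := by
  obtain ⟨x₁, y₁, h₁, rfl⟩ := geomPoints.exists_eq_some hP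
  obtain ⟨x₂, y₂, h₂, rfl⟩ := geomPoints.exists_eq_some hQ
  simp only [xy_some, Matrix.cons_val_zero] at h
  exact (Affine.Point.X_eq_iff (h₁ := h₁) (h₂ := h₂)).mp h

omit [W'.IsElliptic] in
/-- **The values of a linear pull-back**: if `μ^* x' = a + c x` and `μ^* y' = e + f x + d y`, then
at every point `P` where `μ` agrees with its rational representation (all but finitely many) and
with `μ P ≠ O`, `x'(μ P) = a + c x(P)` and `y'(μ P) = e + f x(P) + d y(P)` (`(μ^* z)(P) = z(μ P)`,
the tree's `hasValueAt_pullbackHom`, and uniqueness of values). Silverman, *AEC*, II.§2.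
[folklore] -/
theorem xy_apply_eq_of_pullback_eq_lin (μ : Isogeny W W') {a c e f d : AlgebraicClosure K}
    (hx : μ.pullbackX = algebraMap _ W.geomFunctionField a + algebraMap _ W.geomFunctionField c * W.genX)
    (hy : μ.pullbackY = algebraMap _ W.geomFunctionField e + algebraMap _ W.geomFunctionField f * W.genX +
        algebraMap _ W.geomFunctionField d * W.genY)
    {P : W.geomPoints}
    (hP : AgreesWithRationalMapAt W W' μ.rationalRep.P₁ μ.rationalRep.Q₁ μ.rationalRep.P₂
      μ.rationalRep.Q₂ μ P)
    (hμP : μ P ≠ 0) :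
    xy (μ P) 0 = a + c * xy P 0 ∧ xy (μ P) 1 = e + f * xy P 0 + d * xy P 1 := by
  have hP0 : P ≠ 0 := (agreesWithRationalMapAt_iff.mp hP).1
  constructor
  · have h₁ := μ.hasValueAt_pullbackHom hP hμP (hasValueAt_gen (μ P) 0)
    have h₁' : W.HasValueAt (algebraMap _ W.geomFunctionField a +
        algebraMap _ W.geomFunctionField c * W.genX) P (xy (μ P) 0) :=
      h₁.congr (by simp [hx]) rfl
    have h₂ : W.HasValueAt (algebraMap _ W.geomFunctionField a +
        algebraMap _ W.geomFunctionField c * W.genX) P (a + c * xy P 0) :=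
      (hasValueAt_algebraMap a P).add ((hasValueAt_algebraMap c P).mul
        (by simpa using hasValueAt_gen P 0))
    exact h₁'.unique hP0 h₂
  · have h₁ := μ.hasValueAt_pullbackHom hP hμP (hasValueAt_gen (μ P) 1)
    have h₁' : W.HasValueAt (algebraMap _ W.geomFunctionField e +
        algebraMap _ W.geomFunctionField f * W.genX + algebraMap _ W.geomFunctionField d * W.genY) P
        (xy (μ P) 1) :=
      h₁.congr (by simp [hy]) rfl
    have h₂ : W.HasValueAt (algebraMap _ W.geomFunctionField e +
        algebraMap _ W.geomFunctionField f * W.genX + algebraMap _ W.geomFunctionField d * W.genY) P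
        (e + f * xy P 0 + d * xy P 1) :=
      ((hasValueAt_algebraMap e P).add ((hasValueAt_algebraMap f P).mul
        (by simpa using hasValueAt_gen P 0))).add
        ((hasValueAt_algebraMap d P).mul (by simpa using hasValueAt_gen P 1))
    exact h₁'.unique hP0 h₂

omit [W'.IsElliptic] in
/-- **The coefficients of a linear pull-back along a `K`-isogeny are fixed by `Γ_K`.** If the
isogeny `μ : E → E'` over `K` is injective on `K̄`-points and `μ^* x' = a + c x`,
`μ^* y' = e + f x + d y`, then `σa = a, …, σd = d` for every `σ ∈ Γ_K = Gal(K̄/K)`: `μ` commutes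
with `σ` (`μ(σP) = σ(μP)`), so comparing coordinates at a generic `P`, at `-P` and at a second
generic `P'` gives `a + c σx = σa + σc σx`, `e + f σx + d σy = σe + σf σx + σd σy` for two values
of `x` and two of `y`. Silverman, *AEC*, II.§2 (functions defined over `K`), III.§1.
[folklore] -/
theorem smul_eq_of_pullback_eq_lin (μ : Isogeny W W') (hinj : ∀ P, μ P = 0 → P = 0)
    {a c e f d : AlgebraicClosure K}
    (hx : μ.pullbackX = algebraMap _ W.geomFunctionField a + algebraMap _ W.geomFunctionField c * W.genX)
    (hy : μ.pullbackY = algebraMap _ W.geomFunctionField e + algebraMap _ W.geomFunctionField f * W.genX +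
        algebraMap _ W.geomFunctionField d * W.genY)
    (σ : Field.absoluteGaloisGroup K) :
    σ • a = a ∧ σ • c = c ∧ σ • e = e ∧ σ • f = f ∧ σ • d = d := by
  -- the finite bad set and the coordinate identities off it
  set B : Set W.geomPoints := {P | ¬ AgreesWithRationalMapAt W W' μ.rationalRep.P₁ μ.rationalRep.Q₁
    μ.rationalRep.P₂ μ.rationalRep.Q₂ μ P} with hB
  have hBfin : B.Finite := μ.rationalRep.finite
  have hval : ∀ P, P ∉ B →
      xy (μ P) 0 = a + c * xy P 0 ∧ xy (μ P) 1 = e + f * xy P 0 + d * xy P 1 := by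
    intro P hP
    have hP' : AgreesWithRationalMapAt W W' μ.rationalRep.P₁ μ.rationalRep.Q₁ μ.rationalRep.P₂
        μ.rationalRep.Q₂ μ P := by
      simpa [hB] using hP
    have hP0 : P ≠ 0 := (agreesWithRationalMapAt_iff.mp hP').1
    exact xy_apply_eq_of_pullback_eq_lin μ hx hy hP' fun h ↦ hP0 (hinj P h)
  -- off `B ∪ σ⁻¹ B`: the two Galois identities
  have hEq : ∀ P, P ∉ B → σ • P ∉ B →
      a + c * (σ • xy P 0) = σ • a + σ • c * (σ • xy P 0) ∧
      e + f * (σ • xy P 0) + d * (σ • xy P 1) =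
        σ • e + σ • f * (σ • xy P 0) + σ • d * (σ • xy P 1) := by
    intro P hP hσP
    obtain ⟨h0, h1⟩ := hval P hP
    obtain ⟨h0', h1'⟩ := hval (σ • P) hσP
    rw [μ.map_smul] at h0' h1'
    simp only [geomPoints.xy_absoluteGaloisGroup_smul] at h0' h1'
    rw [h0] at h0'
    rw [h1] at h1'
    simp only [smul_add, smul_mul'] at h0' h1'
    exact ⟨h0'.symm, h1'.symm⟩
  -- choice of the points
  have hB₂fin : (B ∪ (σ • ·) ⁻¹' B).Finite := hBfin.union (hBfin.preimage (MulAction.injective σ).injOn)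
  have hNfin : ((fun P : W.geomPoints ↦ -P) ⁻¹' (B ∪ (σ • ·) ⁻¹' B)).Finite :=
    hB₂fin.preimage neg_injective.injOn
  have hTfin : {P : W.geomPoints | 2 • P = 0}.Finite := geomPoints.finite_setOf_nsmul_eq_zero two_ne_zero
  obtain ⟨P₁, hP₁⟩ := ((hB₂fin.union hNfin).union hTfin).infinite_compl.nonempty
  simp only [Set.mem_compl_iff, Set.mem_union, Set.mem_preimage, Set.mem_setOf_eq, not_or] at hP₁
  obtain ⟨⟨⟨hP₁B, hP₁σ⟩, hnP₁B, hnP₁σ⟩, hP₁2⟩ := hP₁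
  have hP₁0 : P₁ ≠ 0 := fun h ↦ hP₁2 (by rw [h, smul_zero])
  have hP₁ne : P₁ ≠ -P₁ := fun h ↦ hP₁2 (by rw [two_nsmul]; nth_rw 2 [h]; exact add_neg_cancel P₁)
  obtain ⟨x₁, y₁, hxy₁, hP₁e⟩ := geomPoints.exists_eq_some hP₁0
  obtain ⟨hxy₁', hnP₁e⟩ : ∃ h', -P₁ = (Affine.Point.some x₁
      ((W.baseChange (AlgebraicClosure K)).toAffine.negY x₁ y₁) h' : W.geomPoints) :=
    ⟨_, by rw [hP₁e]; rfl⟩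
  have hy₁ : y₁ ≠ (W.baseChange (AlgebraicClosure K)).toAffine.negY x₁ y₁ := by
    intro h
    apply hP₁ne
    rw [hnP₁e, hP₁e]
    have key : ∀ (y' : AlgebraicClosure K)
        (h' : (W.baseChange (AlgebraicClosure K)).toAffine.Nonsingular x₁ y'), y₁ = y' →
        (Affine.Point.some x₁ y₁ hxy₁ : W.geomPoints) = Affine.Point.some x₁ y' h' := by
      rintro y' h' rfl
      rfl
    exact key _ _ h
  -- a second point with a different `x`-coordinate
  have hEfin : (({0} ∪ ({P₁} ∪ {-P₁})) : Set W.geomPoints).Finite := Set.toFinite _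
  obtain ⟨P₂, hP₂⟩ := (hB₂fin.union hEfin).infinite_compl.nonempty
  simp only [Set.mem_compl_iff, Set.mem_union, Set.mem_preimage, Set.mem_singleton_iff,
    not_or] at hP₂
  obtain ⟨⟨hP₂B, hP₂σ⟩, hP₂0, hP₂ne, hP₂ne'⟩ := hP₂
  obtain ⟨x₂, y₂, hxy₂, hP₂e⟩ := geomPoints.exists_eq_some hP₂0
  have hx₁₂ : x₁ ≠ x₂ := by
    intro h
    rcases eq_or_eq_neg_of_xy_zero_eq hP₁0 hP₂0 (by rw [hP₁e, hP₂e, xy_some, xy_some]; simpa using h)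
      with h' | h'
    · exact hP₂ne h'.symm
    · exact hP₂ne' (by rw [h', neg_neg])
  -- the identities at `P₁`, `-P₁`, `P₂`
  rw [hP₁e] at hP₁B hP₁σ
  rw [hnP₁e] at hnP₁B hnP₁σ
  rw [hP₂e] at hP₂B hP₂σ
  obtain ⟨eX1, eY1⟩ := hEq _ hP₁B hP₁σ
  obtain ⟨-, eY1'⟩ := hEq _ hnP₁B hnP₁σ
  obtain ⟨eX2, eY2⟩ := hEq _ hP₂B hP₂σ
  simp only [xy_some, Matrix.cons_val_zero, Matrix.cons_val_one] at eX1 eY1 eY1' eX2 eY2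
  -- injectivity of `σ` on `K̄`
  have hσinj : Function.Injective fun z : AlgebraicClosure K ↦ σ • z := fun z z' h ↦ by
    simpa using congrArg (fun w ↦ σ⁻¹ • w) h
  have hx : σ • x₁ - σ • x₂ ≠ 0 := sub_ne_zero.mpr fun h ↦ hx₁₂ (hσinj h)
  have hy' : σ • y₁ - σ • (W.baseChange (AlgebraicClosure K)).toAffine.negY x₁ y₁ ≠ 0 :=
    sub_ne_zero.mpr fun h ↦ hy₁ (hσinj h)
  -- `c`, then `a`
  have hc : σ • c = c := by
    have h : (c - σ • c) * (σ • x₁ - σ • x₂) = 0 := by linear_combination eX1 - eX2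
    exact (sub_eq_zero.mp ((mul_eq_zero.mp h).resolve_right hx)).symm
  have ha : σ • a = a := by
    have h : a - σ • a = 0 := by linear_combination eX1 + (σ • x₁) * hc
    exact (sub_eq_zero.mp h).symm
  -- `d` from `P₁` and `-P₁`
  have hd : σ • d = d := by
    have h : (d - σ • d) * (σ • y₁ - σ • (W.baseChange (AlgebraicClosure K)).toAffine.negY x₁ y₁) = 0 := by
      linear_combination eY1 - eY1'
    exact (sub_eq_zero.mp ((mul_eq_zero.mp h).resolve_right hy')).symm
  -- `f`, then `e`
  have hf : σ • f = f := by
    have h : (f - σ • f) * (σ • x₁ - σ • x₂) = 0 := by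
      linear_combination eY1 - eY2 + (σ • y₁ - σ • y₂) * hd
    exact (sub_eq_zero.mp ((mul_eq_zero.mp h).resolve_right hx)).symm
  have he : σ • e = e := by
    have h : e - σ • e = 0 := by linear_combination eY1 + (σ • x₁) * hf + (σ • y₁) * hd
    exact (sub_eq_zero.mp h).symm
  exact ⟨ha, hc, he, hf, hd⟩

/-- **An isogeny of degree one between elliptic curves over a perfect field is an admissible
change of variables over `K`** (Silverman, *AEC*, Prop. III.3.1(b), for the equations of `E'`
and of `E` pulled back along `μ`): there is `C = (u, r, s, t) ∈ K^* × K³` with `C • W' = W`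
in Mathlib's sense, i.e. `aᵢ(W)` are obtained from `aᵢ(W')` by Table 3.1 — `μ^* x' = u²x + r`,
`μ^* y' = u³y + su²x + t`. Proof: Stages 1–2 give the linear pull-backs and the six identities
over `K̄`; their coefficients are `Γ_K`-fixed (`smul_eq_of_pullback_eq_lin`), hence in `K`
(`K̄^{Γ_K} = K` for `K` perfect, Mathlib's `InfiniteGalois.mem_range_algebraMap_iff_fixed`), and
the identities descend to `K`, where they define the change of variables
(`variableChange_smul_eq_of_relations`). [cite: SilvermanAEC2009, Prop. III.3.1(b)] -/
theorem exists_variableChange_of_deg_eq_one [PerfectField K] (μ : Isogeny W W') (hdeg : μ.deg = 1) :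
    ∃ C : VariableChange K, C • W' = W := by
  obtain ⟨a, c, e, f, d, hc, hd, hx, hy⟩ := exists_pullback_eq_lin_of_deg_eq_one μ hdeg
  have hfix := smul_eq_of_pullback_eq_lin μ (fun P ↦ eq_zero_of_deg_eq_one μ hdeg) hx hy
  -- descent of the five coefficients
  haveI : IsGalois K (AlgebraicClosure K) := {}
  have desc : ∀ z : AlgebraicClosure K, (∀ σ : Field.absoluteGaloisGroup K, σ • z = z) →
      ∃ z₀ : K, algebraMap K (AlgebraicClosure K) z₀ = z := fun z hz ↦
    (InfiniteGalois.mem_range_algebraMap_iff_fixed z).mpr fun g ↦ hz g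
  obtain ⟨a₀, rfl⟩ := desc a fun σ ↦ (hfix σ).1
  obtain ⟨c₀, rfl⟩ := desc c fun σ ↦ (hfix σ).2.1
  obtain ⟨e₀, rfl⟩ := desc e fun σ ↦ (hfix σ).2.2.1
  obtain ⟨f₀, rfl⟩ := desc f fun σ ↦ (hfix σ).2.2.2.1
  obtain ⟨d₀, rfl⟩ := desc d fun σ ↦ (hfix σ).2.2.2.2
  -- the identities over `K`
  obtain ⟨h3, h2, h1, h0, h5, h4⟩ := coeff_relations_of_pullback_eq_lin μ hx hy
  have inj := (algebraMap K (AlgebraicClosure K)).injective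
  have hc₀ : c₀ ≠ 0 := fun h ↦ hc (by rw [h, map_zero])
  have hd₀ : d₀ ≠ 0 := fun h ↦ hd (by rw [h, map_zero])
  refine ⟨_, variableChange_smul_eq_of_relations (a := a₀) (c := c₀) (e := e₀) (f := f₀) (d := d₀)
    W W' hc₀ hd₀ ?_ ?_ ?_ ?_ ?_ ?_⟩
  · apply inj
    simpa only [map_sub, map_pow, map_zero] using h3
  · apply inj
    simpa only [map_add, map_sub, map_mul, map_pow, map_zero, map_ofNat] using h2
  · apply inj
    simpa only [map_add, map_sub, map_mul, map_pow, map_zero, map_ofNat] using h1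
  · apply inj
    simpa only [map_add, map_sub, map_mul, map_pow, map_zero, map_ofNat] using h0
  · apply inj
    simpa only [map_add, map_sub, map_mul, map_pow, map_zero, map_ofNat] using h5
  · apply inj
    simpa only [map_add, map_sub, map_mul, map_pow, map_zero, map_ofNat] using h4

end Descent

end Literature.Computability.Cryptography.Csidh
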